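import Mathlib
import HarnessLib
import Summits.AtomisticToContinuum.FouriersLaw.Theses.JunctionLocality
import Summits.AtomisticToContinuum.FouriersLaw.Theorems.JunctionLocalitySuperadditiveResistanceDeviceLiouville

/-!
# Termination locality in Kubo form, helper IV: the left-block marginal of the device's Gibbs state
(stub `stub_terminationLocality` of line `floating-probe-bypass-laplacian`, crux
`JunctionLocality.SuperadditiveResistance`, stmt-AtomisticToContinuum-11748)

Termination locality compares pairings for the Gibbs state `μ_T^{(N+M)}` of the whole device with
pairings for the Gibbs state `μ_T^{(N)}` of the bare left block, through left-block observables
`F ∘ π_N` (`π_N x = (q|_{<N}, p|_{<N})`). The two are NOT equal (the junction bond tilts the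
left-block marginal by a function of `q_{N−1}`), but the marginal is DOMINATED:

* `hamiltonian_glue`: `H_{N+M}(q_N ⧺ q_M, p_N ⧺ p_M) = H_N(q_N, p_N) + H_M(q_M, p_M) + V(q_M(0) − q_N(N−1))`
  (exact splitting of the energy across the junction bond);
* `measurePreserving_glue`: gluing the blocks preserves Lebesgue measure (Mathlib's
  `sumPiEquivProdPi`/`piCongrLeft finSumFinEquiv`, twice);
* `lintegral_comp_restrictLeft_mul_gibbsDensity_le`: for `V ≥ 0` (here `β ≥ 0`) and `T > 0`,
  `∫ F(π_N x) e^{−H_{N+M}(x)/T} dx ≤ Z_M(T) ∫ F e^{−H_N/T}` for every measurable `F ≥ 0` (Tonelli);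
* `map_restrictLeft_gibbsMeasure_le`: **`(π_N)_* μ_T^{(N+M)} ≤ (Z_N Z_M / Z_{N+M}) · μ_T^{(N)}`** as
  measures; hence `memLp_comp_restrictLeft`, `integrable_comp_restrictLeft`: square-integrable
  (integrable) observables of the bare `N`-chain lift to square-integrable (integrable) observables
  of the device — in particular the bare chain's forward field `g_N ∘ π_N` and the defect
  `u = g_0 − g_N ∘ π_N` of helper I live in `L²(μ_T^{(N+M)})`, where the Kubo-form identities act.

Fixed-`N` statements (the constant `Z_N Z_M / Z_{N+M}` is not claimed uniform here). Folklore.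
-/

noncomputable section

open MeasureTheory Filter Topology
open scoped ContDiff ENNReal
open Literature.MathematicalPhysics.KineticTheory.HeatConduction
open Summit.AtomisticToContinuum.FouriersLaw.Theorems.SuperadditiveResistance.DeviceLiouville

namespace Summit.AtomisticToContinuum.FouriersLaw.Theorems.SuperadditiveResistance.TerminationLocality

/-! ## Gluing the two blocks -/

section Glue

variable {N M : ℕ}

-- adapted from Literature/Analysis/FluidPDE/BBGKYMarginals.lean (`appendMEquiv`)
/-- Juxtaposition of the position (or momentum) tuples of the two blocks, as a measurable
equivalence `(Fin N → ℝ) × (Fin M → ℝ) ≃ᵐ (Fin (N + M) → ℝ)`. -/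
def appendM (N M : ℕ) : (Fin N → ℝ) × (Fin M → ℝ) ≃ᵐ (Fin (N + M) → ℝ) :=
  (MeasurableEquiv.sumPiEquivProdPi fun _ : Fin N ⊕ Fin M => ℝ).symm.trans
    (MeasurableEquiv.piCongrLeft (fun _ : Fin (N + M) => ℝ) finSumFinEquiv)

/-- The inverse of `appendM` splits a tuple into its two blocks. -/
theorem appendM_symm_apply (v : Fin (N + M) → ℝ) :
    (appendM N M).symm v = (fun i => v (Fin.castAdd M i), fun j => v (Fin.natAdd N j)) := by
  change Equiv.sumPiEquivProdPi (fun _ => ℝ)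
    ((Equiv.piCongrLeft (fun _ => ℝ) finSumFinEquiv).symm v) = _
  ext i <;> simp

/-- `appendM` is `Fin.append`. -/
theorem appendM_apply (a : (Fin N → ℝ) × (Fin M → ℝ)) : appendM N M a = Fin.append a.1 a.2 := by
  have h : (appendM N M).symm (Fin.append a.1 a.2) = a := by
    rw [appendM_symm_apply]
    ext <;> simp
  conv_lhs => rw [← h]
  rw [MeasurableEquiv.apply_symm_apply]

/-- Juxtaposition preserves Lebesgue measure. -/
theorem volume_preserving_appendM :
    MeasurePreserving (appendM N M) ((volume : Measure (Fin N → ℝ)).prod volume) volume :=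
  (volume_measurePreserving_sumPiEquivProdPi_symm fun _ : Fin N ⊕ Fin M => ℝ).trans
    (volume_measurePreserving_piCongrLeft (fun _ : Fin (N + M) => ℝ) finSumFinEquiv)

/-- The block data of the device: `((q_N, q_M), (p_N, p_M))`. -/
abbrev BlockData (N M : ℕ) : Type := ((Fin N → ℝ) × (Fin M → ℝ)) × ((Fin N → ℝ) × (Fin M → ℝ))

/-- **Gluing the blocks**: `((q_N, q_M), (p_N, p_M)) ↦ (q_N ⧺ q_M, p_N ⧺ p_M)`. -/
def glue (N M : ℕ) (w : BlockData N M) : PhaseSpace (N + M) :=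
  (Fin.append w.1.1 w.1.2, Fin.append w.2.1 w.2.2)

/-- Gluing is the product of two juxtapositions. -/
theorem glue_eq_prodMap : glue N M = Prod.map (appendM N M) (appendM N M) := by
  funext w
  rw [Prod.map_apply, appendM_apply, appendM_apply]
  rfl

/-- **Gluing preserves Lebesgue measure** (`dq_N dq_M dp_N dp_M ↦ dq dp`). -/
theorem measurePreserving_glue :
    MeasurePreserving (glue N M)
      ((((volume : Measure (Fin N → ℝ)).prod (volume : Measure (Fin M → ℝ))).prod
        ((volume : Measure (Fin N → ℝ)).prod (volume : Measure (Fin M → ℝ)))))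
      (volume : Measure (PhaseSpace (N + M))) := by
  rw [glue_eq_prodMap]
  exact volume_preserving_appendM.prod volume_preserving_appendM

/-- Gluing is measurable. -/
theorem measurable_glue : Measurable (glue N M) := measurePreserving_glue.measurable

/-- The left block of a glued configuration is the left data. -/
theorem restrictLeft_glue (w : BlockData N M) :
    (((glue N M w).1 ∘ Fin.castAdd M, (glue N M w).2 ∘ Fin.castAdd M) : PhaseSpace N) =
      (w.1.1, w.2.1) := by
  refine Prod.ext (funext fun i => ?_) (funext fun i => ?_) <;> simp [glue, Fin.append_left]

/-! ### The energy of a glued configuration -/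

/-- The junction indicator `[N + j = i + 1]` (`i < N`, `j < M`) singles out `i = N−1`, `j = 0`. -/
theorem sum_sum_junction (hN : 1 ≤ N) (hM : 1 ≤ M) (G : Fin N → Fin M → ℝ) :
    (∑ i : Fin N, ∑ j : Fin M, if N + j.val = i.val + 1 then G i j else 0) =
      G ⟨N - 1, by omega⟩ ⟨0, by omega⟩ := by
  rw [Finset.sum_eq_single ⟨N - 1, by omega⟩]
  · rw [Finset.sum_eq_single ⟨0, by omega⟩]
    · simp only [add_zero]
      rw [if_pos (by omega)]
    · intro j _ hj
      rw [if_neg]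
      intro h
      exact hj (Fin.ext (by simp only; omega))
    · intro h; exact absurd (Finset.mem_univ _) h
  · intro i _ hi
    refine Finset.sum_eq_zero fun j _ => ?_
    rw [if_neg]
    intro h
    exact hi (Fin.ext (by have := i.isLt; simp only; omega))
  · intro h; exact absurd (Finset.mem_univ _) h

/-- **Splitting of the energy across the junction bond**:
`H_{N+M}(q_N ⧺ q_M, p_N ⧺ p_M) = H_N(q_N, p_N) + H_M(q_M, p_M) + V(q_M(0) − q_N(N−1))`
(`N, M ≥ 1`; any chain). -/
theorem hamiltonian_glue (P : OscillatorChain) (hN : 1 ≤ N) (hM : 1 ≤ M) (w : BlockData N M) :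
    P.hamiltonian (N + M) (glue N M w) =
      P.hamiltonian N (w.1.1, w.2.1) + P.hamiltonian M (w.1.2, w.2.2) +
        P.V (w.1.2 ⟨0, by omega⟩ - w.1.1 ⟨N - 1, by omega⟩) := by
  simp only [OscillatorChain.hamiltonian, glue, Fin.sum_univ_add, Fin.append_left,
    Fin.append_right, Fin.val_castAdd, Fin.val_natAdd, Finset.sum_add_distrib]
  have hB2 : (∑ i : Fin N, ∑ j : Fin M,
      if N + j.val = i.val + 1 then P.V (w.1.2 j - w.1.1 i) else 0) =
        P.V (w.1.2 ⟨0, by omega⟩ - w.1.1 ⟨N - 1, by omega⟩) :=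
    sum_sum_junction hN hM (fun i j => P.V (w.1.2 j - w.1.1 i))
  have hB3 : (∑ i : Fin M, ∑ j : Fin N,
      if j.val = N + i.val + 1 then P.V (w.1.1 j - w.1.2 i) else 0) = 0 :=
    Finset.sum_eq_zero fun i _ => Finset.sum_eq_zero fun j _ => if_neg (by have := j.isLt; omega)
  have hB4 : (∑ i : Fin M, ∑ j : Fin M,
      if N + j.val = N + i.val + 1 then P.V (w.1.2 j - w.1.2 i) else 0) =
        ∑ i : Fin M, ∑ j : Fin M, if j.val = i.val + 1 then P.V (w.1.2 j - w.1.2 i) else 0 := by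
    refine Finset.sum_congr rfl fun i _ => Finset.sum_congr rfl fun j _ => ?_
    rw [if_congr (show (N + j.val = N + i.val + 1) ↔ (j.val = i.val + 1) by omega) rfl rfl]
  rw [hB2, hB3, hB4]
  ring

end Glue

/-! ## Domination of the left-block marginal -/

section Marginal

variable {ω₂ lam β : ℝ} {N M : ℕ}

/-- For `V ≥ 0` (`β ≥ 0`) and `T > 0` the Gibbs density of the device is dominated by the product of
the blocks' Gibbs densities: `e^{−H_{N+M}(q_N ⧺ q_M, p_N ⧺ p_M)/T} ≤ e^{−H_N/T} e^{−H_M/T}`. -/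
theorem gibbsDensity_glue_le (ω₂ lam : ℝ) (hβ : 0 ≤ β) (γ : ℝ) (hN : 1 ≤ N) (hM : 1 ≤ M) {T : ℝ}
    (hT : 0 < T) (w : BlockData N M) :
    (pinnedChain ω₂ lam β γ).gibbsDensity (N + M) T (glue N M w) ≤
      (pinnedChain ω₂ lam β γ).gibbsDensity N T (w.1.1, w.2.1) *
        (pinnedChain ω₂ lam β γ).gibbsDensity M T (w.1.2, w.2.2) := by
  simp only [OscillatorChain.gibbsDensity, ← Real.exp_add]
  rw [hamiltonian_glue _ hN hM]
  apply Real.exp_le_exp.mpr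
  have hV : 0 ≤ (pinnedChain ω₂ lam β γ).V (w.1.2 ⟨0, by omega⟩ - w.1.1 ⟨N - 1, by omega⟩) := by
    show 0 ≤ (w.1.2 ⟨0, by omega⟩ - w.1.1 ⟨N - 1, by omega⟩) ^ 2 / 2 +
      β * (w.1.2 ⟨0, by omega⟩ - w.1.1 ⟨N - 1, by omega⟩) ^ 4 / 4
    positivity
  have : 0 ≤ (pinnedChain ω₂ lam β γ).V (w.1.2 ⟨0, by omega⟩ - w.1.1 ⟨N - 1, by omega⟩) / T :=
    div_nonneg hV hT.le
  have e : -( (pinnedChain ω₂ lam β γ).hamiltonian N (w.1.1, w.2.1) +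
      (pinnedChain ω₂ lam β γ).hamiltonian M (w.1.2, w.2.2) +
      (pinnedChain ω₂ lam β γ).V (w.1.2 ⟨0, by omega⟩ - w.1.1 ⟨N - 1, by omega⟩)) / T =
      -(pinnedChain ω₂ lam β γ).hamiltonian N (w.1.1, w.2.1) / T +
        -(pinnedChain ω₂ lam β γ).hamiltonian M (w.1.2, w.2.2) / T -
        (pinnedChain ω₂ lam β γ).V (w.1.2 ⟨0, by omega⟩ - w.1.1 ⟨N - 1, by omega⟩) / T := by ring
  rw [e]
  linarith

/-- **Tonelli bound for the left-block marginal of the device's Gibbs density**: for measurable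
`F ≥ 0` on the left block, `∫ F(π_N x) e^{−H_{N+M}(x)/T} dx ≤ Z_M(T) · ∫ F e^{−H_N/T}`
(`β ≥ 0`, `T > 0`, `N, M ≥ 1`). -/
theorem lintegral_comp_restrictLeft_mul_gibbsDensity_le (ω₂ lam : ℝ) (hβ : 0 ≤ β) (γ : ℝ)
    (hN : 1 ≤ N) (hM : 1 ≤ M) {T : ℝ} (hT : 0 < T) {F : PhaseSpace N → ℝ≥0∞} (hF : Measurable F) :
    ∫⁻ x : PhaseSpace (N + M), F (x.1 ∘ Fin.castAdd M, x.2 ∘ Fin.castAdd M) *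
        ENNReal.ofReal ((pinnedChain ω₂ lam β γ).gibbsDensity (N + M) T x) ≤
      (pinnedChain ω₂ lam β γ).partitionFunction M T *
        ∫⁻ y : PhaseSpace N, F y * ENNReal.ofReal ((pinnedChain ω₂ lam β γ).gibbsDensity N T y) := by
  set P := pinnedChain ω₂ lam β γ with hP
  have hρc : ∀ L, Continuous (P.gibbsDensity L T) := fun L =>
    pinnedChain_continuous_gibbsDensity ω₂ lam β γ L T
  have hρm : ∀ L, Measurable fun x => ENNReal.ofReal (P.gibbsDensity L T x) := fun L =>
    (hρc L).measurable.ennreal_ofReal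
  -- the integrand on the device and its pull-back to block data
  set G : PhaseSpace (N + M) → ℝ≥0∞ := fun x =>
    F (x.1 ∘ Fin.castAdd M, x.2 ∘ Fin.castAdd M) * ENNReal.ofReal (P.gibbsDensity (N + M) T x)
    with hG
  have hπ : Measurable fun x : PhaseSpace (N + M) =>
      ((x.1 ∘ Fin.castAdd M, x.2 ∘ Fin.castAdd M) : PhaseSpace N) := by
    refine Measurable.prodMk ?_ ?_
    · exact measurable_pi_lambda _ fun i => (measurable_pi_apply _).comp measurable_fst
    · exact measurable_pi_lambda _ fun i => (measurable_pi_apply _).comp measurable_snd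
  have hGm : Measurable G := (hF.comp hπ).mul (hρm _)
  -- block-data integrands
  set A : PhaseSpace N → ℝ≥0∞ := fun y => F y * ENNReal.ofReal (P.gibbsDensity N T y) with hA
  set B : PhaseSpace M → ℝ≥0∞ := fun z => ENNReal.ofReal (P.gibbsDensity M T z) with hB
  have hAm : Measurable A := hF.mul (hρm _)
  have hBm : Measurable B := hρm _
  -- change of variables along the gluing map
  have h1 : ∫⁻ x, G x = ∫⁻ w, G (glue N M w)
      ∂((((volume : Measure (Fin N → ℝ)).prod (volume : Measure (Fin M → ℝ))).prod
        ((volume : Measure (Fin N → ℝ)).prod (volume : Measure (Fin M → ℝ))))) :=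
    (measurePreserving_glue.lintegral_comp hGm).symm
  -- pointwise domination on block data
  have h2 : ∀ w : BlockData N M, G (glue N M w) ≤ A (w.1.1, w.2.1) * B (w.1.2, w.2.2) := by
    intro w
    simp only [hG, hA, hB]
    rw [restrictLeft_glue, mul_assoc, ← ENNReal.ofReal_mul (P.gibbsDensity_pos N T _).le]
    exact mul_le_mul' le_rfl (ENNReal.ofReal_le_ofReal (gibbsDensity_glue_le ω₂ lam hβ γ hN hM hT w))
  -- Tonelli on the block data
  have h3 : ∫⁻ w, A (w.1.1, w.2.1) * B (w.1.2, w.2.2)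
      ∂((((volume : Measure (Fin N → ℝ)).prod (volume : Measure (Fin M → ℝ))).prod
        ((volume : Measure (Fin N → ℝ)).prod (volume : Measure (Fin M → ℝ))))) =
      (∫⁻ y, A y) * ∫⁻ z, B z := by
    have hH : Measurable fun w : BlockData N M => A (w.1.1, w.2.1) * B (w.1.2, w.2.2) := by
      refine Measurable.mul (hAm.comp ?_) (hBm.comp ?_)
      · exact (measurable_fst.comp measurable_fst).prodMk (measurable_fst.comp measurable_snd)
      · exact (measurable_snd.comp measurable_fst).prodMk (measurable_snd.comp measurable_snd)
    rw [lintegral_prod _ hH.aemeasurable]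
    -- inner integral over (p_N, p_M)
    have hin : ∀ qq : (Fin N → ℝ) × (Fin M → ℝ),
        ∫⁻ pp : (Fin N → ℝ) × (Fin M → ℝ), A (qq.1, pp.1) * B (qq.2, pp.2)
          ∂((volume : Measure (Fin N → ℝ)).prod (volume : Measure (Fin M → ℝ))) =
        (∫⁻ pN, A (qq.1, pN)) * ∫⁻ pM, B (qq.2, pM) := by
      intro qq
      exact lintegral_prod_mul (hAm.comp (measurable_const.prodMk measurable_id)).aemeasurable
        (hBm.comp (measurable_const.prodMk measurable_id)).aemeasurable
    simp_rw [hin]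
    -- outer integral over (q_N, q_M)
    have ha : Measurable fun qN : Fin N → ℝ => ∫⁻ pN, A (qN, pN) := hAm.lintegral_prod_right'
    have hb : Measurable fun qM : Fin M → ℝ => ∫⁻ pM, B (qM, pM) := hBm.lintegral_prod_right'
    rw [lintegral_prod_mul ha.aemeasurable hb.aemeasurable]
    congr 1
    · exact (lintegral_prod A hAm.aemeasurable).symm
    · exact (lintegral_prod B hBm.aemeasurable).symm
  calc ∫⁻ x, G x = _ := h1
    _ ≤ ∫⁻ w, A (w.1.1, w.2.1) * B (w.1.2, w.2.2) ∂_ := lintegral_mono h2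
    _ = (∫⁻ y, A y) * ∫⁻ z, B z := h3
    _ = P.partitionFunction M T * ∫⁻ y, A y := by rw [mul_comm]; rfl

/-- **The left-block marginal of the device's Gibbs state is dominated by the bare block's Gibbs
state**: `(π_N)_* μ_T^{(N+M)} ≤ (Z_{N+M}⁻¹ Z_N Z_M) · μ_T^{(N)}` (pinned chain, `ω₂ > 0`,
`lam, β ≥ 0`, `T > 0`, `N, M ≥ 1`). The density of the marginal is `e^{−H_N/T}` tilted by a function
of `q_{N−1}` bounded by `Z_M`; no uniformity of the constant in `N, M` is claimed. -/
theorem map_restrictLeft_gibbsMeasure_le (hω : 0 < ω₂) (hl : 0 ≤ lam) (hβ : 0 ≤ β) (γ : ℝ)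
    (hN : 1 ≤ N) (hM : 1 ≤ M) {T : ℝ} (hT : 0 < T) :
    ((pinnedChain ω₂ lam β γ).gibbsMeasure (N + M) T).map
        (fun x : PhaseSpace (N + M) => ((x.1 ∘ Fin.castAdd M, x.2 ∘ Fin.castAdd M) : PhaseSpace N)) ≤
      (((pinnedChain ω₂ lam β γ).partitionFunction (N + M) T)⁻¹ *
        ((pinnedChain ω₂ lam β γ).partitionFunction N T *
          (pinnedChain ω₂ lam β γ).partitionFunction M T)) •
        (pinnedChain ω₂ lam β γ).gibbsMeasure N T := by
  set P := pinnedChain ω₂ lam β γ with hP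
  have hπ : Measurable fun x : PhaseSpace (N + M) =>
      ((x.1 ∘ Fin.castAdd M, x.2 ∘ Fin.castAdd M) : PhaseSpace N) := by
    refine Measurable.prodMk ?_ ?_
    · exact measurable_pi_lambda _ fun i => (measurable_pi_apply _).comp measurable_fst
    · exact measurable_pi_lambda _ fun i => (measurable_pi_apply _).comp measurable_snd
  have hρc : ∀ L, Continuous (P.gibbsDensity L T) := fun L =>
    pinnedChain_continuous_gibbsDensity ω₂ lam β γ L T
  have hρm : ∀ L, Measurable fun x => ENNReal.ofReal (P.gibbsDensity L T x) := fun L =>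
    (hρc L).measurable.ennreal_ofReal
  have hint : ∀ L, Integrable (P.gibbsDensity L T) := fun L =>
    pinnedChain_integrable_gibbsDensity hω hl hβ γ L hT
  have hZ0 : P.partitionFunction N T ≠ 0 := P.partitionFunction_ne_zero (hρc N)
  have hZt : P.partitionFunction N T ≠ ⊤ := P.partitionFunction_ne_top (hint N)
  rw [Measure.le_iff]
  intro s hs
  rw [Measure.map_apply hπ hs, P.gibbsMeasure_eq_smul_withDensity (hint _),
    P.gibbsMeasure_eq_smul_withDensity (hint _), Measure.smul_apply, Measure.smul_apply,
    Measure.smul_apply, withDensity_apply _ (hπ hs), withDensity_apply _ hs, smul_eq_mul,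
    smul_eq_mul, smul_eq_mul]
  -- the two set integrals as integrals of indicators
  have hL : ∫⁻ x in (fun x : PhaseSpace (N + M) =>
        ((x.1 ∘ Fin.castAdd M, x.2 ∘ Fin.castAdd M) : PhaseSpace N)) ⁻¹' s,
      ENNReal.ofReal (P.gibbsDensity (N + M) T x) =
      ∫⁻ x : PhaseSpace (N + M), s.indicator 1 (x.1 ∘ Fin.castAdd M, x.2 ∘ Fin.castAdd M) *
        ENNReal.ofReal (P.gibbsDensity (N + M) T x) := by
    rw [← lintegral_indicator (hπ hs)]
    refine lintegral_congr fun x => ?_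
    by_cases hx : ((x.1 ∘ Fin.castAdd M, x.2 ∘ Fin.castAdd M) : PhaseSpace N) ∈ s
    · have hx' : x ∈ (fun x : PhaseSpace (N + M) =>
          ((x.1 ∘ Fin.castAdd M, x.2 ∘ Fin.castAdd M) : PhaseSpace N)) ⁻¹' s := hx
      rw [Set.indicator_of_mem hx', Set.indicator_of_mem hx]
      simp
    · have hx' : x ∉ (fun x : PhaseSpace (N + M) =>
          ((x.1 ∘ Fin.castAdd M, x.2 ∘ Fin.castAdd M) : PhaseSpace N)) ⁻¹' s := hx
      rw [Set.indicator_of_notMem hx', Set.indicator_of_notMem hx]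
      simp
  have hR : ∫⁻ y in s, ENNReal.ofReal (P.gibbsDensity N T y) =
      ∫⁻ y : PhaseSpace N, s.indicator 1 y * ENNReal.ofReal (P.gibbsDensity N T y) := by
    rw [← lintegral_indicator hs]
    refine lintegral_congr fun y => ?_
    by_cases hy : y ∈ s
    · rw [Set.indicator_of_mem hy, Set.indicator_of_mem hy]
      simp
    · rw [Set.indicator_of_notMem hy, Set.indicator_of_notMem hy]
      simp
  rw [hL, hR]
  have key := lintegral_comp_restrictLeft_mul_gibbsDensity_le ω₂ lam hβ γ hN hM hT
    (F := s.indicator 1) ((measurable_const).indicator hs)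
  calc (P.partitionFunction (N + M) T)⁻¹ *
        ∫⁻ x : PhaseSpace (N + M), s.indicator 1 (x.1 ∘ Fin.castAdd M, x.2 ∘ Fin.castAdd M) *
          ENNReal.ofReal (P.gibbsDensity (N + M) T x)
      ≤ (P.partitionFunction (N + M) T)⁻¹ * (P.partitionFunction M T *
          ∫⁻ y : PhaseSpace N, s.indicator 1 y * ENNReal.ofReal (P.gibbsDensity N T y)) :=
        mul_le_mul' le_rfl key
    _ = (P.partitionFunction (N + M) T)⁻¹ * (P.partitionFunction N T * P.partitionFunction M T) *
          ((P.partitionFunction N T)⁻¹ *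
            ∫⁻ y : PhaseSpace N, s.indicator 1 y * ENNReal.ofReal (P.gibbsDensity N T y)) := by
        rw [show (P.partitionFunction (N + M) T)⁻¹ * (P.partitionFunction N T * P.partitionFunction M T) *
            ((P.partitionFunction N T)⁻¹ *
              ∫⁻ y : PhaseSpace N, s.indicator 1 y * ENNReal.ofReal (P.gibbsDensity N T y)) =
            (P.partitionFunction (N + M) T)⁻¹ * (P.partitionFunction M T *
              ((P.partitionFunction N T * (P.partitionFunction N T)⁻¹) *
                ∫⁻ y : PhaseSpace N, s.indicator 1 y * ENNReal.ofReal (P.gibbsDensity N T y))) by ring,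
          ENNReal.mul_inv_cancel hZ0 hZt, one_mul]

/-- The domination constant is finite. -/
theorem marginal_const_ne_top (hω : 0 < ω₂) (hl : 0 ≤ lam) (hβ : 0 ≤ β) (γ : ℝ) (N M : ℕ)
    {T : ℝ} (hT : 0 < T) :
    ((pinnedChain ω₂ lam β γ).partitionFunction (N + M) T)⁻¹ *
        ((pinnedChain ω₂ lam β γ).partitionFunction N T *
          (pinnedChain ω₂ lam β γ).partitionFunction M T) ≠ ⊤ := by
  have hρc : ∀ L, Continuous ((pinnedChain ω₂ lam β γ).gibbsDensity L T) := fun L =>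
    pinnedChain_continuous_gibbsDensity ω₂ lam β γ L T
  have hint : ∀ L, Integrable ((pinnedChain ω₂ lam β γ).gibbsDensity L T) := fun L =>
    pinnedChain_integrable_gibbsDensity hω hl hβ γ L hT
  refine ENNReal.mul_ne_top ?_ (ENNReal.mul_ne_top ?_ ?_)
  · exact ENNReal.inv_ne_top.mpr ((pinnedChain ω₂ lam β γ).partitionFunction_ne_zero (hρc _))
  · exact (pinnedChain ω₂ lam β γ).partitionFunction_ne_top (hint _)
  · exact (pinnedChain ω₂ lam β γ).partitionFunction_ne_top (hint _)

/-- **`L^p` observables of the bare left block lift to `L^p` observables of the device**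
(`ω₂ > 0`, `lam, β ≥ 0`, `T > 0`, `N, M ≥ 1`; any exponent). -/
theorem memLp_comp_restrictLeft (hω : 0 < ω₂) (hl : 0 ≤ lam) (hβ : 0 ≤ β) (γ : ℝ) (hN : 1 ≤ N)
    (hM : 1 ≤ M) {T : ℝ} (hT : 0 < T) {p : ℝ≥0∞} {f : PhaseSpace N → ℝ}
    (hf : MemLp f p ((pinnedChain ω₂ lam β γ).gibbsMeasure N T)) :
    MemLp (fun x : PhaseSpace (N + M) => f (x.1 ∘ Fin.castAdd M, x.2 ∘ Fin.castAdd M)) p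
      ((pinnedChain ω₂ lam β γ).gibbsMeasure (N + M) T) := by
  have hπ : Measurable fun x : PhaseSpace (N + M) =>
      ((x.1 ∘ Fin.castAdd M, x.2 ∘ Fin.castAdd M) : PhaseSpace N) := by
    refine Measurable.prodMk ?_ ?_
    · exact measurable_pi_lambda _ fun i => (measurable_pi_apply _).comp measurable_fst
    · exact measurable_pi_lambda _ fun i => (measurable_pi_apply _).comp measurable_snd
  have h1 := hf.of_measure_le_smul (marginal_const_ne_top hω hl hβ γ N M hT)
    (map_restrictLeft_gibbsMeasure_le hω hl hβ γ hN hM hT)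
  exact h1.comp_of_map hπ.aemeasurable

/-- **Integrable observables of the bare left block lift to integrable observables of the device.** -/
theorem integrable_comp_restrictLeft (hω : 0 < ω₂) (hl : 0 ≤ lam) (hβ : 0 ≤ β) (γ : ℝ)
    (hN : 1 ≤ N) (hM : 1 ≤ M) {T : ℝ} (hT : 0 < T) {f : PhaseSpace N → ℝ}
    (hf : Integrable f ((pinnedChain ω₂ lam β γ).gibbsMeasure N T)) :
    Integrable (fun x : PhaseSpace (N + M) => f (x.1 ∘ Fin.castAdd M, x.2 ∘ Fin.castAdd M))
      ((pinnedChain ω₂ lam β γ).gibbsMeasure (N + M) T) := by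
  rw [← memLp_one_iff_integrable] at hf ⊢
  exact memLp_comp_restrictLeft hω hl hβ γ hN hM hT hf


/-- Registered helper sub-goal `helper_terminationMarginal` (= `map_restrictLeft_gibbsMeasure_le` in
stub form): the left-block marginal of the device's Gibbs state is dominated by the bare block's. -/
theorem helper_terminationMarginal : ∀ {ω₂ lam β : ℝ}, 0 < ω₂ → 0 ≤ lam → 0 ≤ β → ∀ (γ : ℝ) {N M : ℕ}, 1 ≤ N → 1 ≤ M → ∀ {T : ℝ}, 0 < T → ((pinnedChain ω₂ lam β γ).gibbsMeasure (N + M) T).map (fun x : PhaseSpace (N + M) => ((x.1 ∘ Fin.castAdd M, x.2 ∘ Fin.castAdd M) : PhaseSpace N)) ≤ (((pinnedChain ω₂ lam β γ).partitionFunction (N + M) T)⁻¹ * ((pinnedChain ω₂ lam β γ).partitionFunction N T * (pinnedChain ω₂ lam β γ).partitionFunction M T)) • (pinnedChain ω₂ lam β γ).gibbsMeasure N T :=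
  fun hω hl hβ γ _ _ hN hM _ hT => map_restrictLeft_gibbsMeasure_le hω hl hβ γ hN hM hT

end Marginal

end Summit.AtomisticToContinuum.FouriersLaw.Theorems.SuperadditiveResistance.TerminationLocality

end
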